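import Summits.KontsevichZagierPeriods.KontsevichZagierPeriods.Theses.TerasomaMultiplication
import Literature.NumberTheory.Transcendental.KZKernelConjectureForms

/-!
# `GapSectorBeyondTwelve` (stmt-KontsevichZagierPeriods-14858) — position of the item in the route

Support item of route `TerasomaMultiplication` (the "residual Γ-Hodge sector": crux 5
`GammaHodgeSector` VERBATIM, restricted by ONE extra hypothesis to the Beta data whose symbol
difference `D = Σⱼ[xⱼ,yⱼ] − Σₗ[x'ₗ,y'ₗ] − k·[½,½]` lies outside the span of the standard relator
pairs `⊔ ℤ·g₁₂`).  This file records, kernel-checked, where the item sits; it claims neither a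
proof nor a refutation of the item.

* `of_gammaHodgeSector` — crux 5 implies the item (the extra hypothesis is idle: it is never
  used), so the item is never stronger than crux 5;
* `of_summit` — the summit `KontsevichZagierPeriods` implies the item (every instance is an
  instance of the two-representation form `KZPeriodConjecture'` of Conjecture 1, which the tree
  proves equivalent to the summit, `kzPeriodConjecture'_iff_isRational`);
* (contrapositive, not stated as a theorem: a refutation of the item would refute the summit as
  formalised, so no evaluation-based kill exists — `KZ.relations ≤ ker eval` is proved and value
  equality is a hypothesis of the item.)

What the item asserts beyond these reductions — KZ-accessibility of the Yamamoto–Das / Anderson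
2-torsion Γ-classes other than the level-12 one (first instance: Das's level-15 linear pair
`B(4/15,1/5) = c·B(1/3,2/15)`, `c` algebraic), for ALL levels and all word lengths — is recorded
on the ledger item as an open-problem verdict with the arithmetic of the first instance.
[Kontsevich–Zagier 2001, §1.2 Conjecture 1; Deligne 1982, Thm 7.18 + Koblitz–Ogus appendix;
Das 2000]
-/

namespace Summit.KontsevichZagierPeriods.TerasomaMultiplication.GapSectorBeyondTwelve

open Summit.KontsevichZagierPeriods.KontsevichZagierPeriods.Theses.TerasomaMultiplication
open Literature.NumberTheory.Transcendental

/-- **Crux 5 implies the item.** `GapSectorBeyondTwelve` is `GammaHodgeSector` with one extra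
hypothesis (the symbol-level exclusion `D ∉ closure(relator pairs) ⊔ ℤ·g₁₂`), which is simply
dropped: same binders, same pinned cube and `2k`-ball × cube representations, same Hodge-type,
algebraicity and equal-value hypotheses. [folklore] -/
theorem of_gammaHodgeSector (h : GammaHodgeSector) : GapSectorBeyondTwelve := by
  intro N N' k x y x' y' c hx hx' hH hc _ r r' hd hi hd' hi' hv
  exact h N N' k x y x' y' c hx hx' hH hc r r' hd hi hd' hi' hv

/-- **The summit implies the item.** Every instance of `GapSectorBeyondTwelve` is an instance of
the two-representation form `KZPeriodConjecture'` of Kontsevich–Zagier's Conjecture 1 (only the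
hypothesis `r.value = r'.value` is used), and `KZPeriodConjecture'` is equivalent to the summit
`KontsevichZagierPeriods` (`kzPeriodConjecture'_iff_isRational`: algebraic integrands are
equivalent by the moves to rational ones). Hence the item is summit-implied: it carves out a
sector of Conjecture 1 and is never stronger than it.
[cite: KontsevichZagier2001, §1.2 Conjecture 1] -/
theorem of_summit (h : KontsevichZagierPeriods) : GapSectorBeyondTwelve := by
  intro N N' k x y x' y' c _ _ _ _ _ r r' _ _ _ _ hv
  exact kzPeriodConjecture'_iff_isRational.mpr h r r' hv

end Summit.KontsevichZagierPeriods.TerasomaMultiplication.GapSectorBeyondTwelve
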